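import Mathlib
import HarnessLib
import Summits.ValiantsHypothesis.ValiantsHypothesis.Theses.MonotoneRestoration
import Summits.ValiantsHypothesis.ValiantsHypothesis.Theorems.MonotoneRestorationQP.Negative.LoadBearing
import Literature.Computability.AlgebraicComplexity.DawarWilsenach2025
import Literature.Computability.AlgebraicComplexity.DawarWilsenach2025Thm71

/-! # Route MonotoneRestoration — crux `MonotoneRestorationQP`: the `VP` hypothesis of L1 is load-bearing
(stmt-ValiantsHypothesis-15886, line Sketch v10, lead c5)

Line Sketch v10 cuts the crux into L1 (`stub_orbitRestoration`: matrix-symmetric `VP` families over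
`ℂ` have square-symmetric circuits of quasi-polynomial ORBIT size) and L2 (orbit → size
compression). `Negative/OrbitCompressionFalseWithoutVP.lean` (p163656) shows that L2 minus
`IsVPFamily` is false (degree witness). This file records the companion certificate for L1: L1 minus
`IsVPFamily` is FALSE, by the permanent — matrix-symmetric (`rename_perm_perPoly`), and of orbit size
`≥ 2^{ε n}` infinitely often in every square-symmetric circuit family computing it (Dawar–Wilsenach
2025, Thm 7.1, proved in the tree: `DawarWilsenach2025_thm71_holds`), versus `2^{(log₂ n + c)^c}`
(`polylog_pow_lt_linear`). So both halves of the cut use `VP` essentially: L1 through the EXCLUSION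
of the permanent (it decides VH), L2 through degree/size.
-/

noncomputable section

-- `Summit.ValiantsHypothesis.ValiantsHypothesis.…` is the tree's mandated namespace (Sub = Summit).
set_option linter.dupNamespace false

namespace Summit.ValiantsHypothesis.ValiantsHypothesis.Theorems

open Literature.Computability.AlgebraicComplexity
open Filter

/-- **The `VP` hypothesis of L1 is load-bearing**: "every matrix-symmetric family over `ℂ` has
square-symmetric circuits of quasi-polynomial orbit size" is FALSE — the permanent is
matrix-symmetric and, by Dawar–Wilsenach Thm 7.1 in ORBIT form, every square-symmetric circuit
family computing it has orbit size `≥ 2^{ε n}` infinitely often. [cite: DawarWilsenach2025, Thm. 7.1 (p. 18)] -/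
theorem orbitRestoration_false_without_VP :
    ¬ (∀ f : (n : ℕ) → MvPolynomial (Fin n × Fin n) ℂ,
      (∀ (n : ℕ) (σ τ : Equiv.Perm (Fin n)),
        MvPolynomial.rename (fun p : Fin n × Fin n => (σ p.1, τ p.2)) (f n) = f n) →
      ∃ c : ℕ, ∀ n : ℕ, ∃ (G : Type) (_ : Fintype G)
        (C : LabelledArithCircuit ℂ (Fin n × Fin n) Unit G),
        C.IsSymmetric (Equiv.Perm (Fin n)) ∧ C.eval (C.output ()) = f n ∧
          C.orbitSize (Equiv.Perm (Fin n)) ≤ 2 ^ ((Nat.log 2 n + c) ^ c)) := by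
  intro h
  have hsymm : ∀ (n : ℕ) (σ τ : Equiv.Perm (Fin n)),
      MvPolynomial.rename (fun p : Fin n × Fin n => (σ p.1, τ p.2)) (perPoly (Fin n) ℂ) =
        perPoly (Fin n) ℂ := by
    intro n σ τ
    have h' := congrArg (MvPolynomial.map (Complex.ofRealHom.comp NNReal.toRealHom))
      (MonotoneRestorationQP.Negative.rename_perm_perPoly n σ τ)
    rw [MvPolynomial.map_rename, map_perPoly] at h'
    exact h'
  obtain ⟨c, hc⟩ := h (fun n => perPoly (Fin n) ℂ) hsymm
  choose G inst C hCsymm hCeval hCorb using hc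
  obtain ⟨ε, hε, hfreq⟩ := @DawarWilsenach2025_thm71_holds ℂ _ _ G inst C hCsymm hCeval
  obtain ⟨n₀, key⟩ := MonotoneRestorationQP.Negative.polylog_pow_lt_linear c hε
  obtain ⟨n, hle, hn⟩ := (hfreq.and_eventually (eventually_ge_atTop n₀)).exists
  have horb : (((C n).orbitSize (Equiv.Perm (Fin n)) : ℕ) : ℝ) ≤
      (2 : ℝ) ^ (((Nat.log 2 n + c) ^ c : ℕ) : ℝ) := by
    rw [Real.rpow_natCast]
    exact_mod_cast hCorb n
  have hlt : (2 : ℝ) ^ (((Nat.log 2 n + c) ^ c : ℕ) : ℝ) < (2 : ℝ) ^ (ε * n) := by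
    apply (Real.rpow_lt_rpow_left_iff one_lt_two).2
    have := key n hn
    push_cast at this ⊢
    exact this
  exact absurd (hle.trans horb) (not_le.mpr hlt)

end Summit.ValiantsHypothesis.ValiantsHypothesis.Theorems

end
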